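import Summits.HodgeConjecture.HodgeConjecture.Theorems.HeckePrymWeilWeilTwelvefoldsSqrtMinus7IsotypicHeckePrymPlaneDimension
import Summits.HodgeConjecture.HodgeConjecture.Theorems.HeckePrymWeilWeilTwelvefoldsSqrtMinus7IsotypicHeckePrymPlaneGalois
import Literature.AlgebraicGeometry.Motives.JacobianFirstCohomologyAssembly
import HarnessLib

/-!
# Chevalley–Weil for the étale `ℤ/7`-subcover from `H¹(J) ≅ H¹(C)` alone; `stub_heckePrymWeilPlane` granted it

Helper file for line `isotypic-unimodular-saturation`, stub `stub_heckePrymWeilPlane`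
(`--supports stmt-HodgeConjecture-1261`).  It DISCHARGES the Chevalley–Weil hypothesis `hCW` of
`stub_heckePrymWeilPlane_of_chevalleyWeil` (`…IsotypicHeckePrymPlaneDimension`) from ONE input taken as
a hypothesis — the named fact `hI : Motives.isIso_bettiCohomology_map_abelJacobi` (`H¹(J(C)) ≅ H¹(C)`,
Lange 2023 §4.1.1; UNPROVED in the tree, reduced there to `Motives.two_mul_dim_eq_finrank_bettiCohomology`
by `JacobianFirstCohomologyAssembly.isIso_bettiCohomology_map_abelJacobi_holds_of` and the proved torsion
count).  NO Lefschetz fixed-point theorem: the traces `tr((σ^*)ʲ | H¹(C)) = 2` of the free order-`7`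
automorphism are PROVED in `…IsotypicHeckePrymPlaneGalois` (Smith theory + Galois symmetry).

Chain (`chevalleyWeil_finrank_eigenspace_of_isIso`): `tr((σ_*^*)ʲ | H¹(J)) = tr((σ^*)ʲ | H¹(C)) = 2` by
`hI` (`trace_pow_complexBetti_map_pushforward_eq`); `dim H¹(J) = 86`; hence the `ζ₇`-eigenspace of
`σ_*^*` on `H¹(J)` has dimension `(86 - 2)/7 = 12` (`…Multiplicity.finrank_eigenspace_eq_twelve`); and
`ι^* : H¹(J) ↠ H¹(B)`, `B = (ker Φ₇(σ_*))⁰`, is an equivariant surjection with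
`dim H¹(B) = dim ker Φ₇(σ_*^*)` (`AbelianVarietyHOneExactness.two_mul_dim_kerComponent_eq_finrank_ker`)
killing `im Φ₇(σ_*^*)`, so the multiplicity of `ζ₇` in `H¹(B)` is also `12`
(`…Multiplicity.finrank_eigenspace_eq_of_surjective`).  Consequently
**`stub_heckePrymWeilPlane_of_isIso : hI → <the registered stub, verbatim>`**: the stub of the line is
proved CONDITIONALLY on the single named fact `Motives.isIso_bettiCohomology_map_abelJacobi`.
-/

noncomputable section

set_option linter.dupNamespace false

open CategoryTheory Polynomial
open Literature.AlgebraicGeometry Literature.AlgebraicGeometry.Motives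
  Literature.AlgebraicGeometry.HodgeTheory Literature.AlgebraicTopology.SingularHomology

namespace Summit.HodgeConjecture.HodgeConjecture.Theorems.WeilTwelvefoldsSqrtMinus7.IsotypicUnimodularSaturation

/-! ### The Jacobian and the Prym: `(s^*)⁷ = 1`, `Φ₇(s)^* = Φ₇(s^*)` -/

/-- `(s^*)⁷ = 1` on `H¹` for `s⁷ = 𝟙`. [folklore] -/
theorem complexBetti_map_one_hom_pow_seven {J : AbelianVariety ℂ} {s : J ⟶ J}
    (hs7 : s ≫ s ≫ s ≫ s ≫ s ≫ s ≫ s = 𝟙 J) : (complexBetti.map s.hom.hom.hom 1).hom ^ 7 = 1 := by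
  have h := congrArg (fun t : J ⟶ J => (complexBetti.map t.hom.hom.hom 1).hom) hs7
  dsimp only at h
  iterate 6 rw [complexBetti_map_comp_hom] at h
  simp only [ModuleCat.hom_comp] at h
  change _ = (complexBetti.map (𝟙 J.X) 1).hom at h
  rw [complexBetti.map_id, ModuleCat.hom_id, ← Module.End.one_eq_id] at h
  rw [← h]
  simp only [pow_succ, pow_zero, one_mul, Module.End.mul_eq_comp, LinearMap.comp_assoc]

/-- `Φ₇(s)^* = Φ₇(s^*)` on `H¹` (additivity and functoriality of pull-back on `H¹`). [folklore] -/
theorem complexBetti_map_cyclotomic₇_one_hom {J : AbelianVariety ℂ} (s : J ⟶ J) :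
    (complexBetti.map (𝟙 J + s + s ≫ s + s ≫ s ≫ s + s ≫ s ≫ s ≫ s + s ≫ s ≫ s ≫ s ≫ s +
        s ≫ s ≫ s ≫ s ≫ s ≫ s).hom.hom.hom 1).hom =
      aeval (complexBetti.map s.hom.hom.hom 1).hom
        (1 + X + X ^ 2 + X ^ 3 + X ^ 4 + X ^ 5 + X ^ 6 : ℂ[X]) := by
  have hid : (complexBetti.map (𝟙 J : J ⟶ J).hom.hom.hom 1).hom = 1 := by
    change (complexBetti.map (𝟙 J.X) 1).hom = 1
    rw [complexBetti.map_id]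
    rfl
  rw [complexBetti_map_add_one, complexBetti_map_add_one, complexBetti_map_add_one,
    complexBetti_map_add_one, complexBetti_map_add_one, complexBetti_map_add_one]
  simp only [ModuleCat.hom_add]
  repeat rw [complexBetti_map_comp_hom]
  simp only [ModuleCat.hom_comp, hid, map_add, map_pow, map_one, aeval_X]
  simp only [pow_succ', pow_zero, mul_one, Module.End.mul_eq_comp]

/-! ### Chevalley–Weil for the cyclic subcover, and the stub granted `hI` -/

/-- **Chevalley–Weil multiplicity `12` for the étale cyclic `ℤ/7`-cover of genus `43 → 7`**, from
`H¹(J(C)) ≅ H¹(C)` (`hI`, the named fact `Motives.isIso_bettiCohomology_map_abelJacobi`) ALONE: the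
hypothesis `hCW` of `stub_heckePrymWeilPlane_of_chevalleyWeil`, verbatim (Patel–Zhang 2025 Lemma 2.9 /
Lemma 5.1; Schoen 1988 Lemma 1.5: every non-trivial character of `ℤ/7` occurs `h = 12` times in
`H¹(B)`).  CONDITIONAL on `hI`. [cite: PatelZhang2025PrymHodge, Lemma 2.9 and Lemma 5.1]
[cite: Lange2023AbelianVarietiesC, §4.1.1 and Lemma 4.4.1] -/
theorem chevalleyWeil_finrank_eigenspace_of_isIso (hI : isIso_bettiCohomology_map_abelJacobi) :
    ∀ (C : SchemeOver ℂ) (𝒥 : Jacobian C) (σ : C ⟶ C),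
      IsSmoothProjective 1 C → 𝒥.J.dim = 43 →
      σ ≫ σ ≫ σ ≫ σ ≫ σ ≫ σ ≫ σ = 𝟙 C → (∀ P : ComplexPoints C, P ≫ σ ≠ P) →
    ∀ (s eN : 𝒥.J ⟶ 𝒥.J), s = 𝒥.pushforward 𝒥 σ →
      eN = 𝟙 𝒥.J + s + s ≫ s + s ≫ s ≫ s + s ≫ s ≫ s ≫ s + s ≫ s ≫ s ≫ s ≫ s +
        s ≫ s ≫ s ≫ s ≫ s ≫ s →
    ∀ (sB : AbelianVariety.kerComponent eN ⟶ AbelianVariety.kerComponent eN),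
      sB ≫ AbelianVariety.kerComponentι eN = AbelianVariety.kerComponentι eN ≫ s →
      Module.finrank ℂ (Module.End.eigenspace (complexBetti.map sB.hom.hom.hom 1).hom
        (Complex.exp (2 * (Real.pi : ℂ) * Complex.I / 7) ^ 1)) = 12 := by
  intro C 𝒥 σ hC hg hσ7 hfree s eN hs heN sB hsB
  subst heN
  haveI := finite_complexBetti_abelianVariety 𝒥.J 1
  haveI := finite_complexBetti_abelianVariety (AbelianVariety.kerComponent (𝟙 𝒥.J + s + s ≫ s + s ≫ s ≫ s + s ≫ s ≫ s ≫ s + s ≫ s ≫ s ≫ s ≫ s +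
        s ≫ s ≫ s ≫ s ≫ s ≫ s)) 1
  set T : complexBetti 𝒥.J.X 1 →ₗ[ℂ] complexBetti 𝒥.J.X 1 := (complexBetti.map s.hom.hom.hom 1).hom
    with hT
  set T' := (complexBetti.map sB.hom.hom.hom 1).hom with hT'
  set f := (complexBetti.map (AbelianVariety.kerComponentι (𝟙 𝒥.J + s + s ≫ s + s ≫ s ≫ s + s ≫ s ≫ s ≫ s + s ≫ s ≫ s ≫ s ≫ s +
        s ≫ s ≫ s ≫ s ≫ s ≫ s)).hom.hom.hom 1).hom with hf
  have hT7 : T ^ 7 = 1 :=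
    complexBetti_map_one_hom_pow_seven (pushforward_comp_pow_seven_of_pow_seven 𝒥 hσ7 hs)
  have hT'7 : T' ^ 7 = 1 := complexBetti_map_one_hom_pow_seven
    (comp_pow_seven_eq_id_of_cyclotomic₇ (kerComponent_cyclotomic₇_restrict_eq_zero rfl hsB))
  have hfs : Function.Surjective f :=
    complexBetti_map_one_surjective_of_isClosedImmersion (AbelianVariety.kerComponentι _)
  have hcomm : f ∘ₗ T = T' ∘ₗ f := by
    have h := congrArg (fun g : AbelianVariety.kerComponent (𝟙 𝒥.J + s + s ≫ s + s ≫ s ≫ s + s ≫ s ≫ s ≫ s + s ≫ s ≫ s ≫ s ≫ s +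
        s ≫ s ≫ s ≫ s ≫ s ≫ s) ⟶ 𝒥.J =>
      (complexBetti.map g.hom.hom.hom 1).hom) hsB
    dsimp only at h
    rw [complexBetti_map_comp_hom, complexBetti_map_comp_hom, ModuleCat.hom_comp, ModuleCat.hom_comp] at h
    exact h.symm
  have hΦT := complexBetti_map_cyclotomic₇_one_hom s
  have hW : Module.finrank ℂ (complexBetti (AbelianVariety.kerComponent (𝟙 𝒥.J + s + s ≫ s + s ≫ s ≫ s + s ≫ s ≫ s ≫ s + s ≫ s ≫ s ≫ s ≫ s +
        s ≫ s ≫ s ≫ s ≫ s ≫ s)).X 1) =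
      Module.finrank ℂ (LinearMap.ker (aeval T (1 + X + X ^ 2 + X ^ 3 + X ^ 4 + X ^ 5 + X ^ 6 : ℂ[X]))) := by
    rw [AbelianVariety.finrank_complexBetti_one, two_mul_dim_kerComponent_eq_finrank_ker, hΦT]
  have hker : LinearMap.range (aeval T (1 + X + X ^ 2 + X ^ 3 + X ^ 4 + X ^ 5 + X ^ 6 : ℂ[X])) ≤
      LinearMap.ker f := by
    rintro _ ⟨x, rfl⟩
    rw [LinearMap.mem_ker, ← hΦT]
    have h := congrArg (fun g : AbelianVariety.kerComponent (𝟙 𝒥.J + s + s ≫ s + s ≫ s ≫ s + s ≫ s ≫ s ≫ s + s ≫ s ≫ s ≫ s ≫ s +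
        s ≫ s ≫ s ≫ s ≫ s ≫ s) ⟶ 𝒥.J =>
      (complexBetti.map g.hom.hom.hom 1).hom x) (AbelianVariety.kerComponentι_comp (𝟙 𝒥.J + s + s ≫ s + s ≫ s ≫ s + s ≫ s ≫ s ≫ s + s ≫ s ≫ s ≫ s ≫ s +
        s ≫ s ≫ s ≫ s ≫ s ≫ s))
    dsimp only at h
    rw [map_comp_one_apply, complexBetti_map_zero_one, ModuleCat.hom_zero, LinearMap.zero_apply] at h
    exact h
  have hV : Module.finrank ℂ (complexBetti 𝒥.J.X 1) = 86 := by
    rw [AbelianVariety.finrank_complexBetti_one, hg]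
  have htr : ∀ j : ℕ, 1 ≤ j → j ≤ 6 → LinearMap.trace ℂ _ (T ^ j) = 2 := by
    intro j hj1 hj6
    rw [hT, hs, trace_pow_complexBetti_map_pushforward_eq 𝒥 hI hC σ j]
    exact trace_pow_complexBetti_map_one_eq_two_of_free hC σ hσ7 hfree j hj1 hj6
  have h12 := finrank_eigenspace_eq_twelve T hT7 hV zeta7_pow_seven zeta7_cyclotomic htr
  rw [pow_one, finrank_eigenspace_eq_of_surjective T T' f hfs hcomm hT7 hT'7 hW hker zeta7_pow_seven
    zeta7_cyclotomic]
  exact h12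

/-- **`stub_heckePrymWeilPlane` GRANTED `H¹(J) ≅ H¹(C)`.**  The registered stub of line
`isotypic-unimodular-saturation` (crux `HeckePrymWeil.WeilTwelvefoldsSqrtMinus7`), in its exact signature,
follows from the single named fact `Motives.isIso_bettiCohomology_map_abelJacobi` (`hI`, unproved in the
tree).  Everything else — conjunct 1 (`dim P' = 12`: Chevalley–Weil via Smith theory, Galois symmetry,
`H¹`-exactness), conjunct 2 (`φ'² = -7`), conjunct 3 (the typed Weil plane of the Hecke–Prym is one
restriction of Schoen's lines) — is PROVED in the tree.  CONDITIONAL on `hI` only.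
[cite: Lange2023AbelianVarietiesC, §4.1.1 and Lemma 4.4.1] -/
theorem stub_heckePrymWeilPlane_of_isIso (hI : isIso_bettiCohomology_map_abelJacobi) :
    ∀ (C : SchemeOver ℂ) (𝒥 : Jacobian C) (σ τ : C ⟶ C),
      IsSmoothProjective 1 C → 𝒥.J.dim = 43 →
      σ ≫ σ ≫ σ ≫ σ ≫ σ ≫ σ ≫ σ = 𝟙 C → τ ≫ τ ≫ τ = 𝟙 C → σ ≫ τ = τ ≫ σ ≫ σ →
      (∀ P : ComplexPoints C, P ≫ σ ≠ P ∧ P ≫ τ ≠ P) →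
    ∀ (s t eN : 𝒥.J ⟶ 𝒥.J), s = 𝒥.pushforward 𝒥 σ → t = 𝒥.pushforward 𝒥 τ →
      eN = 𝟙 𝒥.J + s + s ≫ s + s ≫ s ≫ s + s ≫ s ≫ s ≫ s + s ≫ s ≫ s ≫ s ≫ s +
        s ≫ s ≫ s ≫ s ≫ s ≫ s →
    ∀ (sB tB : AbelianVariety.kerComponent eN ⟶ AbelianVariety.kerComponent eN),
      sB ≫ AbelianVariety.kerComponentι eN = AbelianVariety.kerComponentι eN ≫ s →
      tB ≫ AbelianVariety.kerComponentι eN = AbelianVariety.kerComponentι eN ≫ t →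
    ∀ (φ' : AbelianVariety.kerComponent (𝟙 (AbelianVariety.kerComponent eN) - tB) ⟶
        AbelianVariety.kerComponent (𝟙 (AbelianVariety.kerComponent eN) - tB)),
      φ' ≫ AbelianVariety.kerComponentι (𝟙 (AbelianVariety.kerComponent eN) - tB) =
        AbelianVariety.kerComponentι (𝟙 (AbelianVariety.kerComponent eN) - tB) ≫
          (sB + sB ≫ sB + sB ≫ sB ≫ sB ≫ sB - sB ≫ sB ≫ sB - sB ≫ sB ≫ sB ≫ sB ≫ sB -
            sB ≫ sB ≫ sB ≫ sB ≫ sB ≫ sB) →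
    (∀ a : ℕ, 1 ≤ a → a ≤ 6 →
      ∀ c : complexBetti (AbelianVariety.kerComponent eN).X 12,
        c ∈ Module.End.eigenspace
            (complexBetti.map ((2 : ℤ) • 𝟙 (AbelianVariety.kerComponent eN) + sB).hom.hom.hom 12).hom
            ((2 + Complex.exp (2 * (Real.pi : ℂ) * Complex.I / 7) ^ a) ^ 12) →
        c ∈ algebraicClasses (AbelianVariety.kerComponent eN).X 6) →
    (AbelianVariety.kerComponent (𝟙 (AbelianVariety.kerComponent eN) - tB)).dim = 12 ∧
    φ' ≫ φ' = -((7 : ℤ) • 𝟙 (AbelianVariety.kerComponent (𝟙 (AbelianVariety.kerComponent eN) - tB))) ∧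
    ∀ c : complexBetti (AbelianVariety.kerComponent (𝟙 (AbelianVariety.kerComponent eN) - tB)).X 12,
      c ∈ Module.End.eigenspace (complexBetti.map
              (𝟙 (AbelianVariety.kerComponent (𝟙 (AbelianVariety.kerComponent eN) - tB)) + φ').hom.hom.hom
              12).hom ((1 + Complex.I * (Real.sqrt (7 : ℝ) : ℂ)) ^ 12) ⊔
          Module.End.eigenspace (complexBetti.map
              (𝟙 (AbelianVariety.kerComponent (𝟙 (AbelianVariety.kerComponent eN) - tB)) + φ').hom.hom.hom
              12).hom ((1 - Complex.I * (Real.sqrt (7 : ℝ) : ℂ)) ^ 12) →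
      c ∈ algebraicClasses (AbelianVariety.kerComponent (𝟙 (AbelianVariety.kerComponent eN) - tB)).X 6  :=
  stub_heckePrymWeilPlane_of_chevalleyWeil (chevalleyWeil_finrank_eigenspace_of_isIso hI)

/-- **`stub_heckePrymWeilPlane` GRANTED `dim J(C) = g(C)`** (the root named fact
`Motives.two_mul_dim_eq_finrank_bettiCohomology`: `2 · dim J = b₁(C(ℂ))`, Milne, *Jacobian Varieties*,
Prop. 2.1 with Thm. 2.5 — UNPROVED in the tree): `H¹(J) ≅ H¹(C)` follows from it and the proved torsion
count `|A[n](ℂ)| = n^{2 dim A}` (`JacobianFirstCohomologyAssembly.isIso_bettiCohomology_map_abelJacobi_holds_of`,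
`AbelianVariety.natCard_torsionPoints_of_isAlgClosed_holds`).  CONDITIONAL on that fact only.
[cite: Milne1986JacobianVarieties, §2 Prop. 2.1 and Thm. 2.5] -/
theorem stub_heckePrymWeilPlane_of_two_mul_dim_eq_finrank_bettiCohomology
    (h : two_mul_dim_eq_finrank_bettiCohomology) :
    ∀ (C : SchemeOver ℂ) (𝒥 : Jacobian C) (σ τ : C ⟶ C),
      IsSmoothProjective 1 C → 𝒥.J.dim = 43 →
      σ ≫ σ ≫ σ ≫ σ ≫ σ ≫ σ ≫ σ = 𝟙 C → τ ≫ τ ≫ τ = 𝟙 C → σ ≫ τ = τ ≫ σ ≫ σ →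
      (∀ P : ComplexPoints C, P ≫ σ ≠ P ∧ P ≫ τ ≠ P) →
    ∀ (s t eN : 𝒥.J ⟶ 𝒥.J), s = 𝒥.pushforward 𝒥 σ → t = 𝒥.pushforward 𝒥 τ →
      eN = 𝟙 𝒥.J + s + s ≫ s + s ≫ s ≫ s + s ≫ s ≫ s ≫ s + s ≫ s ≫ s ≫ s ≫ s +
        s ≫ s ≫ s ≫ s ≫ s ≫ s →
    ∀ (sB tB : AbelianVariety.kerComponent eN ⟶ AbelianVariety.kerComponent eN),
      sB ≫ AbelianVariety.kerComponentι eN = AbelianVariety.kerComponentι eN ≫ s →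
      tB ≫ AbelianVariety.kerComponentι eN = AbelianVariety.kerComponentι eN ≫ t →
    ∀ (φ' : AbelianVariety.kerComponent (𝟙 (AbelianVariety.kerComponent eN) - tB) ⟶
        AbelianVariety.kerComponent (𝟙 (AbelianVariety.kerComponent eN) - tB)),
      φ' ≫ AbelianVariety.kerComponentι (𝟙 (AbelianVariety.kerComponent eN) - tB) =
        AbelianVariety.kerComponentι (𝟙 (AbelianVariety.kerComponent eN) - tB) ≫
          (sB + sB ≫ sB + sB ≫ sB ≫ sB ≫ sB - sB ≫ sB ≫ sB - sB ≫ sB ≫ sB ≫ sB ≫ sB -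
            sB ≫ sB ≫ sB ≫ sB ≫ sB ≫ sB) →
    (∀ a : ℕ, 1 ≤ a → a ≤ 6 →
      ∀ c : complexBetti (AbelianVariety.kerComponent eN).X 12,
        c ∈ Module.End.eigenspace
            (complexBetti.map ((2 : ℤ) • 𝟙 (AbelianVariety.kerComponent eN) + sB).hom.hom.hom 12).hom
            ((2 + Complex.exp (2 * (Real.pi : ℂ) * Complex.I / 7) ^ a) ^ 12) →
        c ∈ algebraicClasses (AbelianVariety.kerComponent eN).X 6) →
    (AbelianVariety.kerComponent (𝟙 (AbelianVariety.kerComponent eN) - tB)).dim = 12 ∧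
    φ' ≫ φ' = -((7 : ℤ) • 𝟙 (AbelianVariety.kerComponent (𝟙 (AbelianVariety.kerComponent eN) - tB))) ∧
    ∀ c : complexBetti (AbelianVariety.kerComponent (𝟙 (AbelianVariety.kerComponent eN) - tB)).X 12,
      c ∈ Module.End.eigenspace (complexBetti.map
              (𝟙 (AbelianVariety.kerComponent (𝟙 (AbelianVariety.kerComponent eN) - tB)) + φ').hom.hom.hom
              12).hom ((1 + Complex.I * (Real.sqrt (7 : ℝ) : ℂ)) ^ 12) ⊔
          Module.End.eigenspace (complexBetti.map
              (𝟙 (AbelianVariety.kerComponent (𝟙 (AbelianVariety.kerComponent eN) - tB)) + φ').hom.hom.hom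
              12).hom ((1 - Complex.I * (Real.sqrt (7 : ℝ) : ℂ)) ^ 12) →
      c ∈ algebraicClasses (AbelianVariety.kerComponent (𝟙 (AbelianVariety.kerComponent eN) - tB)).X 6  :=
  stub_heckePrymWeilPlane_of_isIso (isIso_bettiCohomology_map_abelJacobi_holds_of h
    fun _ 𝒥 => AbelianVariety.natCard_torsionPoints_of_isAlgClosed_holds 𝒥.J ℂ)

end Summit.HodgeConjecture.HodgeConjecture.Theorems.WeilTwelvefoldsSqrtMinus7.IsotypicUnimodularSaturation

end
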